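import Summits.BirchSwinnertonDyer.BirchSwinnertonDyer.Theorems.GenusKolyvaginAtTwoGenusPrimitiveSupplyAtTwoMultiGenusAlgebra
import Summits.BirchSwinnertonDyer.BirchSwinnertonDyer.Theorems.GenusKolyvaginAtTwoGenusPrimitiveSupplyAtTwoRingClassProduct

/-!
# Route `GenusKolyvaginAtTwo`, crux `GenusPrimitiveSupplyAtTwo` (stmt-BirchSwinnertonDyer-22136), line `genus-supply`:
# `P(n) ≡ Tr_{K[n]/K(√ℓ₁*,…,√ℓ_r*)} y(n) (mod 2E(K[n]))` — the COMPOSITE-LEVEL INTRINSIC genus dictionary, unconditional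

Lead prover seat bsd-line-gk2-p1 (g2). Completes the kernel-checked dictionary of line `genus-supply` (g0: any level
`P(n) ∈ 2E ⟺ G⁺(n) ∈ 2E` with `G⁺(n)` written through the datum's `S`, `σ_ℓ`; prime level intrinsic
`P(ℓ) ≡ Tr_{K[ℓ]/K(√ℓ*)} y(ℓ)`). Here, at EVERY square-free level `n` of Kolyvagin primes at `2`:
  `P(n) ∈ 2E(K[n]) ⟺ Y_n := Σ_{g ∈ Gal(K[n]/K), g√ℓ* = √ℓ* ∀ ℓ∣n} g·y(n) ∈ 2E(K[n])`
(`heegner_exists_two_zsmul_eq_derivedPoint_iff_multiGenusTrace`), for ANY choice of square roots `√ℓ* ∈ K[n]` and any finite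
`T` enumerating that subgroup: `Y_n = Tr_{K[n]/K(√ℓ₁*,…,√ℓ_r*)} y(n)` is the Heegner point of conductor `n` traced to the
MULTI-GENUS field `ℚ(√d_K, √ℓ₁*, …, √ℓ_r*)` — independent of `S`, of the generators `σ_ℓ` and of `D_n`. Ingredients:
`…MultiGenusAlgebra` (abstract: fixed part ≡ even part mod `2A`), `…RingClassProduct` (`G_n = ∏ G_ℓ` as a multi-index
bijection; genus radicals and their sign table), `…GenusReductionComposite` (commuting `σ_ℓ`, norm relations, `2 ∣ a_ℓ`).
So the registered stub C («∃ n, d: `P(n) ∉ 2E(K[n])`») is EXACTLY «∃ n: the multi-genus Heegner point `Y_n` is not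
`2`-divisible in `E(K[n])`» (`exists_derivedPoint_not_two_dvd_of_multiGenusTrace` and converse) — Kolyvagin `2`-primitivity IS
`2`-primitivity of genus-theory Heegner points, at every level (the form in which Birch 1970 ∕ Coates–Li–Tian–Zhai 2015 ∕
Shu–Zhai arXiv:2102.11808 induct on the number of prime factors, there for curves WITH rational `2`-torsion).
Helper for the crux item (`--supports stmt-BirchSwinnertonDyer-22136`, helper mode). No summit and no leaf is proved by
this file; BSD is not proved by any of this.
-/

set_option linter.dupNamespace false -- tree convention: `Summit.BirchSwinnertonDyer.BirchSwinnertonDyer.Theorems` (summit = sub-problem)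

noncomputable section

open scoped Classical

namespace Summit.BirchSwinnertonDyer.BirchSwinnertonDyer.Theorems.GenusKoly

open Finset NumberField WeierstrassCurve Literature.NumberTheory.EllipticCurves
  Literature.NumberTheory.EllipticCurves.ModularForms Literature.NumberTheory.EllipticCurves.KolyvaginOperator
  Summit.BirchSwinnertonDyer.Rank1Residual.X11b.RingClassTower

/-! ## §1 Sign bookkeeping for square roots -/

section Sign

variable {L : Type} [Field L] [Algebra ℚ L]

/-- `σ^i θ = θ` for even `i` and `−θ` for odd `i`, when `σ θ = −θ`. [cite: SilvermanAEC2009, X.2 Prop. 2.4 (proof)] -/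
theorem pow_apply_eq_ite_of_apply_eq_neg {σ : L ≃ₐ[ℚ] L} {θ : L} (hσ : σ θ = -θ) (i : ℕ) :
    (σ ^ i) θ = if Even i then θ else -θ := by
  induction i with
  | zero => simp
  | succ i ih =>
    rw [pow_succ, AlgEquiv.mul_apply, hσ, map_neg, ih]
    by_cases hi : Even i
    · have : ¬ Even (i + 1) := Nat.not_even_iff_odd.mpr (Even.add_one hi)
      simp [hi, this]
    · have : Even (i + 1) := by rw [Nat.not_even_iff_odd] at hi; exact hi.add_one
      simp [hi, this]

/-- **`(g σ^i) θ = θ ↔ (g θ = θ ↔ i even)`** for `θ² ∈ ℚ`, `θ ≠ 0`, `σ θ = −θ` (every automorphism moves `θ` to `±θ`).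
[cite: SilvermanAEC2009, X.2 Prop. 2.4 (proof)] -/
theorem fix_mul_pow_iff_of_apply_eq_neg {σ : L ≃ₐ[ℚ] L} {θ : L} {q : ℚ} (hθ2 : θ ^ 2 = algebraMap ℚ L q) (hθ0 : θ ≠ 0)
    (hσ : σ θ = -θ) (g : L ≃ₐ[ℚ] L) (i : ℕ) : (g * σ ^ i) θ = θ ↔ (g θ = θ ↔ Even i) := by
  haveI : CharZero L := charZero_of_injective_algebraMap (algebraMap ℚ L).injective
  have hne : θ ≠ -θ := ne_neg_of_ne_zero hθ0
  have hne' : -θ ≠ θ := fun h ↦ hne h.symm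
  rw [AlgEquiv.mul_apply, pow_apply_eq_ite_of_apply_eq_neg hσ i]
  rcases algEquiv_apply_eq_or_eq_neg_of_sq_eq hθ2 g with hg | hg
  · by_cases hi : Even i
    · simp [hi, hg]
    · simp [hi, hg, map_neg, hne']
  · by_cases hi : Even i
    · simp [hi, hg, hne']
    · simp [hi, hg, map_neg, hne']

/-- `(g τ^i) θ = θ ↔ g θ = θ` when `τ θ = θ`. [folklore] -/
theorem fix_mul_pow_iff_of_apply_eq {τ : L ≃ₐ[ℚ] L} {θ : L} (hτ : τ θ = θ) (g : L ≃ₐ[ℚ] L) (i : ℕ) :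
    (g * τ ^ i) θ = θ ↔ g θ = θ := by
  have hfix : (τ ^ i) θ = θ := by
    induction i with
    | zero => simp
    | succ i ih => rw [pow_succ, AlgEquiv.mul_apply, hτ, ih]
  rw [AlgEquiv.mul_apply, hfix]

end Sign

/-! ## §2 The Heegner specialisation -/

section Heegner

variable {W : WeierstrassCurve ℚ} [NeZero (W.conductorNorm ℤ)] {K : Type} [Field K] [NumberField K]
  {Dt : ModularParametrizationData W (W.conductorNorm ℤ)} {β : ℤ} {ι : K →+* ℂ}

/-- **The sign table of ANY square roots `θ_ℓ = √ℓ* ∈ K[n]` under the datum's generators**: `θ_ℓ ≠ 0`, `σ_ℓ θ_ℓ = −θ_ℓ`,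
`σ_ℓ' θ_ℓ = θ_ℓ` (`ℓ' ≠ ℓ`), for `n` square-free of Kolyvagin primes at `2` (odd, inert, prime to `d_K`) — from
`exists_genusRadicals` (`…RingClassProduct` §4; the two square roots of `ℓ*` are `±` each other).
[cite: Cox2013, Thm. 9.18, §9.A (p. 180), Thm. 6.1] [cite: GrossLMS1991, §3 (G_ℓ, σ_ℓ)] -/
theorem heegner_genusRadicals_table [W.IsGloballyMinimal] (hK : IsImaginaryQuadratic K) {n : ℕ} (hn : Squarefree n)
    (hKoly : ∀ ℓ ∈ n.primeFactors, Zhang2014.IsKolyvaginPrime (W.conductorNorm ℤ) W K 2 ℓ)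
    (d : KolyvaginHeegnerData Dt β ι n) {θ : ℕ → ringClassField K ι n}
    (hθ : ∀ ℓ ∈ n.primeFactors, θ ℓ ^ 2 = algebraMap ℚ (ringClassField K ι n) ((-1 : ℚ) ^ (ℓ / 2) * ℓ)) :
    ∀ ℓ ∈ n.primeFactors, θ ℓ ≠ 0 ∧ d.σ ℓ (θ ℓ) = -θ ℓ ∧ ∀ ℓ' ∈ n.primeFactors, ℓ' ≠ ℓ → d.σ ℓ' (θ ℓ) = θ ℓ := by
  obtain ⟨θ₀, hθ₀⟩ := exists_genusRadicals hK ι hn (fun ℓ hℓ ↦ (hKoly ℓ hℓ).2.2.2.1)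
    (fun ℓ hℓ ↦ (hKoly ℓ hℓ).2.2.1) d.zpowers_σ
  intro ℓ hℓ
  obtain ⟨h2, _, hflip, hfix⟩ := hθ₀ ℓ hℓ
  have hℓP : ℓ.Prime := Nat.prime_of_mem_primeFactors hℓ
  have hθ0 : θ ℓ ≠ 0 := ne_zero_of_sq_eq_pStar hℓP (hθ ℓ hℓ)
  -- `θ_ℓ = ± θ₀_ℓ`
  have hpm : θ ℓ = θ₀ ℓ ∨ θ ℓ = -θ₀ ℓ := eq_or_eq_neg_of_sq_eq_sq _ _ (by rw [hθ ℓ hℓ, h2])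
  refine ⟨hθ0, ?_, fun ℓ' hℓ' hne ↦ ?_⟩
  · rcases hpm with h | h
    · rw [h, hflip]
    · rw [h, map_neg, hflip]
  · rcases hpm with h | h
    · rw [h, hfix ℓ' hℓ' hne]
    · rw [h, map_neg, hfix ℓ' hℓ' hne]

/-- **Square roots `√ℓ* ∈ K[n]` exist for every `ℓ ∣ n`** (`n` square-free of Kolyvagin primes at `2`), so the subgroup
`{g ∈ Gal(K[n]/K) : g√ℓ* = √ℓ* ∀ ℓ}` of the main theorem can be formed (genus theory of the order of conductor `n`,
Cox Thm. 9.18 / §9.A; `…RingClassProduct` §4). [cite: Cox2013, Thm. 9.18, §9.A (p. 180), Thm. 6.1] -/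
theorem heegner_exists_multiGenusRadicals [W.IsGloballyMinimal] (hK : IsImaginaryQuadratic K) {n : ℕ} (hn : Squarefree n)
    (hKoly : ∀ ℓ ∈ n.primeFactors, Zhang2014.IsKolyvaginPrime (W.conductorNorm ℤ) W K 2 ℓ)
    (d : KolyvaginHeegnerData Dt β ι n) :
    ∃ θ : ℕ → ringClassField K ι n,
      ∀ ℓ ∈ n.primeFactors, θ ℓ ^ 2 = algebraMap ℚ (ringClassField K ι n) ((-1 : ℚ) ^ (ℓ / 2) * ℓ) := by
  obtain ⟨θ₀, hθ₀⟩ := exists_genusRadicals hK ι hn (fun ℓ hℓ ↦ (hKoly ℓ hℓ).2.2.2.1)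
    (fun ℓ hℓ ↦ (hKoly ℓ hℓ).2.2.1) d.zpowers_σ
  exact ⟨θ₀, fun ℓ hℓ ↦ (hθ₀ ℓ hℓ).1⟩

/-- **`S · SPAN = 𝒢_n` injectively**: `(s, t) ↦ st` is injective on `S × SPAN σ (n.primeFactorsList)` (`S` a transversal of
`G_n` in `𝒢_n`, `SPAN ⊆ G_n`). [cite: GrossLMS1991, §4 (4.1) (S, 𝒢_n, G_n)] -/
theorem heegner_injOn_mul_span (hK : IsImaginaryQuadratic K) {n : ℕ} (hn : n ≠ 0) (d : KolyvaginHeegnerData Dt β ι n) :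
    Set.InjOn (fun p : (ringClassField K ι n ≃ₐ[ℚ] ringClassField K ι n) ×
        (ringClassField K ι n ≃ₐ[ℚ] ringClassField K ι n) ↦ p.1 * p.2)
      ↑(d.S ×ˢ n.primeFactorsList.foldr (fun ℓ T ↦ (range (ℓ + 1) ×ˢ T).image (fun p ↦ d.σ ℓ ^ p.1 * p.2))
        ({1} : Finset (ringClassField K ι n ≃ₐ[ℚ] ringClassField K ι n))) := by
  have hsub := foldr_span_subset_ringClassGalOver_one hK ι hn d.zpowers_σ n.primeFactorsList
    (fun ℓ hℓ ↦ List.mem_toFinset.mpr hℓ)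
  rintro ⟨s, t⟩ hst ⟨s', t'⟩ hst' (h : s * t = s' * t')
  rw [Finset.coe_product, Set.mem_prod, Finset.mem_coe, Finset.mem_coe] at hst hst'
  have ht := hsub t hst.2
  have ht' := hsub t' hst'.2
  have hg : s * t ∈ ringClassGal ι n := Subgroup.mul_mem _ (d.S_subset s hst.1) (ringClassGalOver_le_ringClassGal ι n 1 ht)
  obtain ⟨u, -, huniq⟩ := d.S_transversal (s * t) hg
  have hs : s = u := huniq s ⟨hst.1, by rw [mul_inv_rev, mul_assoc, inv_mul_cancel, mul_one]; exact Subgroup.inv_mem _ ht⟩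
  have hs' : s' = u := huniq s' ⟨hst'.1, by
    rw [h, mul_inv_rev, mul_assoc, inv_mul_cancel, mul_one]; exact Subgroup.inv_mem _ ht'⟩
  have hss : s = s' := hs.trans hs'.symm
  subst hss
  exact Prod.ext rfl (mul_left_cancel h)

/-- **`𝒢_n = S · SPAN`**: `g ∈ Gal(K[n]/K)` iff `g = st` with `s ∈ S`, `t ∈ SPAN σ (n.primeFactorsList)` (`S` a transversal
of `G_n`, and GENERATION `G_n ⊆ SPAN`). [cite: GrossLMS1991, §3–§4 (S·G_n = 𝒢_n, G_n ≃ ∏ G_ℓ)] -/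
theorem heegner_mem_ringClassGal_iff_exists_mul_span (hK : IsImaginaryQuadratic K) (hD : NumberField.discr K < -4)
    {n : ℕ} (hn : Squarefree n) (hinert : ∀ ℓ ∈ n.primeFactors, (Ideal.span {(ℓ : 𝓞 K)}).IsPrime)
    (d : KolyvaginHeegnerData Dt β ι n) (g : ringClassField K ι n ≃ₐ[ℚ] ringClassField K ι n) :
    g ∈ ringClassGal ι n ↔ ∃ s ∈ d.S, ∃ t ∈ n.primeFactorsList.foldr
      (fun ℓ T ↦ (range (ℓ + 1) ×ˢ T).image (fun p ↦ d.σ ℓ ^ p.1 * p.2))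
      ({1} : Finset (ringClassField K ι n ≃ₐ[ℚ] ringClassField K ι n)), g = s * t := by
  have hsub := foldr_span_subset_ringClassGalOver_one hK ι hn.ne_zero d.zpowers_σ n.primeFactorsList
    (fun ℓ hℓ ↦ List.mem_toFinset.mpr hℓ)
  constructor
  · intro hg
    obtain ⟨u, ⟨hu, hgu⟩, -⟩ := d.S_transversal g hg
    have ht : u⁻¹ * g ∈ ringClassGalOver ι n 1 := by
      have := Subgroup.inv_mem _ hgu
      rwa [mul_inv_rev, inv_inv] at this
    exact ⟨u, hu, u⁻¹ * g, mem_foldr_span_of_mem_ringClassGalOver_one hK ι hD hn hinert d.zpowers_σ ht,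
      by rw [mul_inv_cancel_left]⟩
  · rintro ⟨s, hs, t, ht, rfl⟩
    exact Subgroup.mul_mem _ (d.S_subset s hs) (ringClassGalOver_le_ringClassGal ι n 1 (hsub t ht))

/-- **`P(n) ≡ Tr_{K[n]/K(√ℓ₁*,…,√ℓ_r*)} y(n) (mod 2E(K[n]))` — THE COMPOSITE-LEVEL INTRINSIC GENUS DICTIONARY, UNCONDITIONAL.**
For `E/ℚ` (globally minimal `W`), `K` imaginary quadratic with the Heegner hypothesis and `d_K < −4`, `n` square-free all of
whose prime factors are Kolyvagin primes at `2` (`Zhang2014.IsKolyvaginPrime N_E W K 2 ℓ`: `ℓ ∤ 2N_E d_K`, inert, `2 ∣ a_ℓ`), the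
tree's datum `d` of conductor `n`, ANY square roots `θ_ℓ ∈ K[n]` of the `ℓ* = (−1)^{(ℓ−1)/2} ℓ` (`ℓ ∣ n`; they exist,
`heegner_exists_multiGenusRadicals`) and ANY finite `T` enumerating `{g ∈ Gal(K[n]/K) : g θ_ℓ = θ_ℓ ∀ ℓ ∣ n} =
Gal(K[n]/K(θ_ℓ : ℓ ∣ n))`:
  `P(n) ∈ 2E(K[n]) ⟺ Σ_{g∈T} g·y(n) ∈ 2E(K[n])`.
The right side — the Heegner point of conductor `n` traced to the multi-genus field `ℚ(√d_K, √ℓ₁*, …, √ℓ_r*)` — mentions neither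
`S` nor the `σ_ℓ` nor `D_n`: at `p = 2`, Kolyvagin's derivative classes ARE genus-theory classes, at every level.
[cite: GrossLMS1991, §3 (3.3), (3.5), Prop. 3.7 (1), §4 (4.1)] [cite: Cox2013, Thm. 9.18, §9.A] [cite: WZhang2014, Notations (xii), §3.7] -/
theorem heegner_exists_two_zsmul_eq_derivedPoint_iff_multiGenusTrace [W.IsElliptic] [W.IsGloballyMinimal]
    (hK : IsImaginaryQuadratic K) (hD : NumberField.discr K < -4)
    (hH : SatisfiesHeegnerHypothesis (W.conductorNorm ℤ) K) {n : ℕ} (hn : Squarefree n)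
    (hKoly : ∀ ℓ ∈ n.primeFactors, Zhang2014.IsKolyvaginPrime (W.conductorNorm ℤ) W K 2 ℓ)
    (d : KolyvaginHeegnerData Dt β ι n) {θ : ℕ → ringClassField K ι n}
    (hθ : ∀ ℓ ∈ n.primeFactors, θ ℓ ^ 2 = algebraMap ℚ (ringClassField K ι n) ((-1 : ℚ) ^ (ℓ / 2) * ℓ))
    (T : Finset (ringClassField K ι n ≃ₐ[ℚ] ringClassField K ι n))
    (hT : ∀ g, g ∈ T ↔ g ∈ ringClassGal ι n ∧ ∀ ℓ ∈ n.primeFactors, g (θ ℓ) = θ ℓ) :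
    (∃ Q : (W.baseChange (ringClassField K ι n)).toAffine.Point, (2 : ℤ) • Q = d.derivedPoint) ↔
      ∃ Q : (W.baseChange (ringClassField K ι n)).toAffine.Point, (2 : ℤ) • Q =
        ∑ g ∈ T, pointGalHom W (ringClassField K ι n) g d.y := by
  haveI : Fact (Nat.Prime 2) := ⟨Nat.prime_two⟩
  have hn0 : n ≠ 0 := hn.ne_zero
  have hinert : ∀ q ∈ n.primeFactors, (Ideal.span {(q : 𝓞 K)}).IsPrime := fun q hq ↦ (hKoly q hq).2.2.2.2.1
  have hN : ∀ q ∈ n.primeFactors, ¬ q ∣ W.conductorNorm ℤ := fun q hq ↦ (hKoly q hq).2.1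
  have htab := heegner_genusRadicals_table hK hn hKoly d hθ
  refine exists_two_zsmul_eq_derivedPoint_iff_fixPart (pointGalHom W (ringClassField K ι n)) d.σ
    (fun ℓ g ↦ g (θ ℓ) = θ ℓ) n hn d.S T d.y ?_ ?_ ?_ ?_ ?_ ?_ ?_
  · -- commuting generators
    intro ℓ hℓ ℓ' hℓ'
    exact heegner_commute_sigma hK hn0 d (List.mem_toFinset.mpr hℓ) (List.mem_toFinset.mpr hℓ')
  · -- `T_ℓ y(n) = a_ℓ y(n/ℓ)' ∈ 2E(K[n])`
    intro ℓ hℓ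
    have hℓ' : ℓ ∈ n.primeFactors := List.mem_toFinset.mpr hℓ
    obtain ⟨y₁, -, hsum⟩ := heegner_sum_pow_sigma_eq_frobeniusTrace_zsmul_of_squarefree hK hD hH hn hinert hN d hℓ'
    obtain ⟨c, hc⟩ := (hKoly ℓ hℓ').dvd.2
    refine ⟨c • y₁, ?_⟩
    rw [hsum, hc, smul_smul]
    norm_num
  · -- `φ_ℓ(g σ_ℓ^i) ↔ (φ_ℓ g ↔ i even)`
    intro ℓ hℓ g i
    have hℓ' : ℓ ∈ n.primeFactors := List.mem_toFinset.mpr hℓ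
    obtain ⟨hθ0, hflip, -⟩ := htab ℓ hℓ'
    exact fix_mul_pow_iff_of_apply_eq_neg (hθ ℓ hℓ') hθ0 hflip g i
  · -- `φ_ℓ(g σ_ℓ'^i) ↔ φ_ℓ g` for `ℓ' ≠ ℓ`
    intro ℓ hℓ ℓ' hℓ' hne g i
    obtain ⟨-, -, hfix⟩ := htab ℓ (List.mem_toFinset.mpr hℓ)
    exact fix_mul_pow_iff_of_apply_eq (hfix ℓ' (List.mem_toFinset.mpr hℓ') hne) g i
  · -- stage injectivity (`G_n = ∏ G_ℓ`, uniqueness)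
    rintro ℓ L' ⟨L₁, hL₁⟩
    exact injOn_stage_of_suffix hK ι hD hn hinert d.zpowers_σ L₁ ℓ L' hL₁.symm
  · -- `(s, t) ↦ st` injective on `S × SPAN`
    exact heegner_injOn_mul_span hK hn0 d
  · -- `T = {st : all φ_ℓ(st)}`
    intro g
    rw [hT, heegner_mem_ringClassGal_iff_exists_mul_span hK hD hn hinert d g]
    simp only [Nat.mem_primeFactors_iff_mem_primeFactorsList]

/-! ## §3 Stub C of line `genus-supply` ⟺ «some multi-genus Heegner trace is not `2`-divisible», frame by frame -/

/-- **Stub C ⟸ a `2`-primitive multi-genus trace.** In the binder frame of the registered stub `stub_genusPrimitivityAtTwo`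
(`K` imaginary quadratic with odd `d_K ≠ −3` and the Heegner hypothesis; `Dt`, `β`, `ι` fixed): a square-free `n` of Kolyvagin
primes at `2`, a datum `d` of conductor `n`, square roots `θ_ℓ = √ℓ* ∈ K[n]` (`ℓ ∣ n`) and a finite `T` enumerating
`Gal(K[n]/K(θ_ℓ : ℓ ∣ n))` with `Σ_{g∈T} g·y(n) ∉ 2E(K[n])` witness the stub's conclusion `P(n) ∉ 2E(K[n])`
(`heegner_exists_two_zsmul_eq_derivedPoint_iff_multiGenusTrace`). [cite: GrossLMS1991, §3 (3.5), Prop. 3.7 (1), §4 (4.1)] -/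
theorem exists_derivedPoint_not_two_dvd_of_multiGenusTrace [W.IsElliptic] [W.IsGloballyMinimal]
    (hK : IsImaginaryQuadratic K) (hodd : Odd (NumberField.discr K)) (h3 : NumberField.discr K ≠ -3)
    (hH : SatisfiesHeegnerHypothesis (W.conductorNorm ℤ) K)
    (h : ∃ (n : ℕ) (d : KolyvaginHeegnerData Dt β ι n) (θ : ℕ → ringClassField K ι n)
      (T : Finset (ringClassField K ι n ≃ₐ[ℚ] ringClassField K ι n)), Squarefree n ∧
      (∀ ℓ ∈ n.primeFactors, Zhang2014.IsKolyvaginPrime (W.conductorNorm ℤ) W K 2 ℓ) ∧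
      (∀ ℓ ∈ n.primeFactors, θ ℓ ^ 2 = algebraMap ℚ (ringClassField K ι n) ((-1 : ℚ) ^ (ℓ / 2) * ℓ)) ∧
      (∀ g, g ∈ T ↔ g ∈ ringClassGal ι n ∧ ∀ ℓ ∈ n.primeFactors, g (θ ℓ) = θ ℓ) ∧
      ¬ ∃ Q : (W.baseChange (ringClassField K ι n)).toAffine.Point, (2 : ℤ) • Q =
        ∑ g ∈ T, pointGalHom W (ringClassField K ι n) g d.y) :
    ∃ (n : ℕ) (d : KolyvaginHeegnerData Dt β ι n), Squarefree n ∧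
      (∀ ℓ ∈ n.primeFactors, Zhang2014.IsKolyvaginPrime (W.conductorNorm ℤ) W K 2 ℓ) ∧
      ¬ ∃ Q : (W.baseChange (ringClassField K ι n)).toAffine.Point, (2 : ℤ) • Q = d.derivedPoint := by
  obtain ⟨n, d, θ, T, hn, hKoly, hθ, hT, hY⟩ := h
  exact ⟨n, d, hn, hKoly, fun hP ↦ hY ((heegner_exists_two_zsmul_eq_derivedPoint_iff_multiGenusTrace hK
    (discr_lt_neg_four_of_odd hK hodd h3) hH hn hKoly d hθ T hT).mp hP)⟩

/-- **… and conversely**: a `2`-primitive `P(n)` gives square roots `θ_ℓ = √ℓ* ∈ K[n]`, the finite set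
`T = Gal(K[n]/K(θ_ℓ : ℓ ∣ n))` (realised inside `S · SPAN = Gal(K[n]/K)`) and a `2`-primitive multi-genus trace
`Σ_{g∈T} g·y(n)` (same `n`, `d`). So stub C is EXACTLY «∃ n: the multi-genus Heegner point of conductor `n` is not `2`-divisible in
`E(K[n])`» — the route's child U at every level, intrinsically. [cite: GrossLMS1991, §3 (3.5), Prop. 3.7 (1), §4 (4.1)]
[cite: Cox2013, Thm. 9.18, §9.A] -/
theorem exists_multiGenusTrace_not_two_dvd_of_derivedPoint [W.IsElliptic] [W.IsGloballyMinimal]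
    (hK : IsImaginaryQuadratic K) (hodd : Odd (NumberField.discr K)) (h3 : NumberField.discr K ≠ -3)
    (hH : SatisfiesHeegnerHypothesis (W.conductorNorm ℤ) K)
    (h : ∃ (n : ℕ) (d : KolyvaginHeegnerData Dt β ι n), Squarefree n ∧
      (∀ ℓ ∈ n.primeFactors, Zhang2014.IsKolyvaginPrime (W.conductorNorm ℤ) W K 2 ℓ) ∧
      ¬ ∃ Q : (W.baseChange (ringClassField K ι n)).toAffine.Point, (2 : ℤ) • Q = d.derivedPoint) :
    ∃ (n : ℕ) (d : KolyvaginHeegnerData Dt β ι n) (θ : ℕ → ringClassField K ι n)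
      (T : Finset (ringClassField K ι n ≃ₐ[ℚ] ringClassField K ι n)), Squarefree n ∧
      (∀ ℓ ∈ n.primeFactors, Zhang2014.IsKolyvaginPrime (W.conductorNorm ℤ) W K 2 ℓ) ∧
      (∀ ℓ ∈ n.primeFactors, θ ℓ ^ 2 = algebraMap ℚ (ringClassField K ι n) ((-1 : ℚ) ^ (ℓ / 2) * ℓ)) ∧
      (∀ g, g ∈ T ↔ g ∈ ringClassGal ι n ∧ ∀ ℓ ∈ n.primeFactors, g (θ ℓ) = θ ℓ) ∧
      ¬ ∃ Q : (W.baseChange (ringClassField K ι n)).toAffine.Point, (2 : ℤ) • Q =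
        ∑ g ∈ T, pointGalHom W (ringClassField K ι n) g d.y := by
  obtain ⟨n, d, hn, hKoly, hP⟩ := h
  have hD := discr_lt_neg_four_of_odd hK hodd h3
  have hinert : ∀ q ∈ n.primeFactors, (Ideal.span {(q : 𝓞 K)}).IsPrime := fun q hq ↦ (hKoly q hq).2.2.2.2.1
  obtain ⟨θ, hθ⟩ := heegner_exists_multiGenusRadicals hK hn hKoly d
  -- `T` realised as the `θ`-fixed elements of `S · SPAN`
  let T : Finset (ringClassField K ι n ≃ₐ[ℚ] ringClassField K ι n) :=
    ((d.S ×ˢ n.primeFactorsList.foldr (fun ℓ T ↦ (range (ℓ + 1) ×ˢ T).image (fun p ↦ d.σ ℓ ^ p.1 * p.2))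
      ({1} : Finset (ringClassField K ι n ≃ₐ[ℚ] ringClassField K ι n))).image
      (fun p : (ringClassField K ι n ≃ₐ[ℚ] ringClassField K ι n) ×
        (ringClassField K ι n ≃ₐ[ℚ] ringClassField K ι n) ↦ p.1 * p.2)).filter
      (fun g ↦ ∀ ℓ ∈ n.primeFactors, g (θ ℓ) = θ ℓ)
  have hT : ∀ g, g ∈ T ↔ g ∈ ringClassGal ι n ∧ ∀ ℓ ∈ n.primeFactors, g (θ ℓ) = θ ℓ := by
    intro g
    rw [Finset.mem_filter, Finset.mem_image, heegner_mem_ringClassGal_iff_exists_mul_span hK hD hn hinert d g]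
    constructor
    · rintro ⟨⟨⟨s, t⟩, hst, rfl⟩, hfix⟩
      exact ⟨⟨s, (Finset.mem_product.mp hst).1, t, (Finset.mem_product.mp hst).2, rfl⟩, hfix⟩
    · rintro ⟨⟨s, hs, t, ht, rfl⟩, hfix⟩
      exact ⟨⟨⟨s, t⟩, Finset.mem_product.mpr ⟨hs, ht⟩, rfl⟩, hfix⟩
  exact ⟨n, d, θ, T, hn, hKoly, hθ, hT, fun hY ↦ hP ((heegner_exists_two_zsmul_eq_derivedPoint_iff_multiGenusTrace hK hD
    hH hn hKoly d hθ T hT).mpr hY)⟩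

end Heegner

end Summit.BirchSwinnertonDyer.BirchSwinnertonDyer.Theorems.GenusKoly

end
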